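import Literature.Analysis.Asymptotics.GaussianDamping
import HarnessLib

/-!
# Gaussian moments on a single leaf and uniform flat bounds along a moving centre
(Sbierski 2015, §3–§4: the leaf integrals `∫_{Σ_τ} (…) e^{-2λ Im φ}` of the energy of a Gaussian
beam; namespace `Literature.Analysis.Asymptotics.GaussianBeam`)

`GaussianDamping.lean` bounds **slab** integrals `∫_{[0,T]×V}` of functions dominated by Gaussian
moments about a moving centre `ξ(t)` (the `L²(R_{[0,T]})` norm of `□u_λ`, Sbierski's first and
second lemmas of §3). The **energy** of a beam, however, is an integral over a single leaf
`Σ_τ = {t = τ}`, needed *uniformly* in `τ ∈ [0, T]` (§4, proof of the theorem: "`E^N_τ(u_λ) =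
λ² ∫_{Σ_τ} |a|² Nφ₁ · n φ₁ e^{-2λφ₂} + lower order terms`", the lower-order terms being
`O(1)` resp. `O(λ^{-1/2})` after integration over the leaf, by the same stretched coordinates
`y̲ = √λ x̲`). This file supplies the leaf versions:

* `integral_norm_sub_pow_mul_exp` — `∫_V ‖y − y₀‖^m e^{-2λ‖y − y₀‖²} dy = (√λ)⁻¹^{m+d} I_m`,
  `I_m = ∫ ‖z‖^m e^{-2‖z‖²}`, for every centre `y₀` (translation and scaling);
  `integrable_norm_sub_pow_mul_exp`;
* `integral_le_of_le_norm_sub_pow_mul_exp`, `norm_integral_le_of_norm_le` — the leaf bound for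
  functions dominated (in norm) by `D ‖y − y₀‖^m e^{-2λ‖y − y₀‖²}` (no regularity needed);
* `exists_norm_le_norm_sub_pow` — **uniform flat bounds from vanishing transversal jets**: for
  `f ∈ C^∞_c(ℝ × V)` whose derivatives of order `≤ S` in `y` vanish along `y = ξ(t)` (`ξ` smooth),
  `‖f(t, y)‖ ≤ D ‖y − ξ(t)‖^{S+1}` for all `t, y` (Taylor along rays after the shear
  `(t, v) ↦ (t, v + ξ(t))`; the step "|f(x)| ≤ C |x̲|^{S+1}" of the proof of the first lemma of §3,
  isolated so that it can be fed to the leaf bounds and to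
  `setIntegral_slab_le_of_le_norm_sub_pow_mul_exp`).

## References

* J. Sbierski, *Characterisation of the energy of Gaussian beams on Lorentzian manifolds: with
  applications to black hole spacetimes*, Anal. PDE 8 (2015) 1379–1420 (arXiv:1311.2477v2):
  §3, first lemma and its proof; §4, proof of the theorem (key `Sbierski2015`).
-/

noncomputable section

open Set Filter MeasureTheory Real
open scoped Topology ContDiff

namespace Literature.Analysis.Asymptotics.GaussianBeam

variable {V : Type*} [NormedAddCommGroup V] [InnerProductSpace ℝ V] [FiniteDimensional ℝ V]
  [MeasurableSpace V] [BorelSpace V]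
variable {E : Type*} [NormedAddCommGroup E] [NormedSpace ℝ E]

/-! ### Gaussian moments about an arbitrary centre on one leaf -/

/-- **Leaf moment about a centre**: `∫ ‖y − y₀‖^m e^{-2λ‖y − y₀‖²} dy = (√λ)⁻¹^{m+d} I_m`.
[cite: Sbierski2015, §4 (proof of the theorem, stretched coordinates)] -/
theorem integral_norm_sub_pow_mul_exp (y₀ : V) (m : ℕ) {lam : ℝ} (hlam : 0 < lam) :
    ∫ y : V, ‖y - y₀‖ ^ m * exp (-2 * lam * ‖y - y₀‖ ^ 2) =
      (√lam)⁻¹ ^ (m + Module.finrank ℝ V) * ∫ z : V, ‖z‖ ^ m * exp (-2 * ‖z‖ ^ 2) := by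
  rw [integral_sub_right_eq_self (fun y : V ↦ ‖y‖ ^ m * exp (-2 * lam * ‖y‖ ^ 2)) y₀]
  exact integral_norm_pow_mul_exp_neg_mul_sq' m hlam

/-- The leaf moment integrand is integrable. [folklore] -/
theorem integrable_norm_sub_pow_mul_exp (y₀ : V) (m : ℕ) {lam : ℝ} (hlam : 0 < lam) :
    Integrable fun y : V ↦ ‖y - y₀‖ ^ m * exp (-2 * lam * ‖y - y₀‖ ^ 2) := by
  -- scale the unit moment by `√λ`, then translate
  have hs : 0 < √lam := Real.sqrt_pos.2 hlam
  have h1 := integrable_norm_pow_mul_exp_neg_two_mul_sq' (V := V) m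
  have h2 : Integrable fun y : V ↦ ‖(√lam : ℝ) • y‖ ^ m * exp (-2 * ‖(√lam : ℝ) • y‖ ^ 2) :=
    h1.comp_smul hs.ne'
  have h3 : Integrable fun y : V ↦ ‖y‖ ^ m * exp (-2 * lam * ‖y‖ ^ 2) := by
    have heq : (fun y : V ↦ ‖y‖ ^ m * exp (-2 * lam * ‖y‖ ^ 2)) =
        fun y ↦ ((√lam) ^ m)⁻¹ * (‖(√lam : ℝ) • y‖ ^ m * exp (-2 * ‖(√lam : ℝ) • y‖ ^ 2)) := by
      funext y
      rw [norm_smul, Real.norm_eq_abs, abs_of_pos hs, mul_pow, mul_pow, Real.sq_sqrt hlam.le]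
      field_simp
    rw [heq]
    exact h2.const_mul _
  exact h3.comp_sub_right y₀

/-- **Leaf bound for a dominated function**: if `F ≤ D ‖y − y₀‖^m e^{-2λ‖y − y₀‖²}` (`D ≥ 0`,
`λ > 0`) then `∫ F ≤ D (√λ)⁻¹^{m+d} I_m` (no regularity of `F`: a non-integrable `F` has
integral `0`). [cite: Sbierski2015, §4 (proof of the theorem)] -/
theorem integral_le_of_le_norm_sub_pow_mul_exp (y₀ : V) (m : ℕ) {D lam : ℝ} (hD : 0 ≤ D)
    (hlam : 0 < lam) {F : V → ℝ}
    (hF : ∀ y, F y ≤ D * (‖y - y₀‖ ^ m * exp (-2 * lam * ‖y - y₀‖ ^ 2))) :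
    ∫ y, F y ≤ D * ((√lam)⁻¹ ^ (m + Module.finrank ℝ V) * ∫ z : V, ‖z‖ ^ m * exp (-2 * ‖z‖ ^ 2)) := by
  have hI : 0 ≤ ∫ z : V, ‖z‖ ^ m * exp (-2 * ‖z‖ ^ 2) :=
    integral_norm_pow_mul_exp_neg_two_mul_sq_nonneg m
  have hRHS : 0 ≤ D * ((√lam)⁻¹ ^ (m + Module.finrank ℝ V) *
      ∫ z : V, ‖z‖ ^ m * exp (-2 * ‖z‖ ^ 2)) := by positivity
  by_cases hint : Integrable F
  · rw [← integral_norm_sub_pow_mul_exp y₀ m hlam, ← integral_const_mul]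
    exact integral_mono hint ((integrable_norm_sub_pow_mul_exp y₀ m hlam).const_mul D) hF
  · rw [integral_undef hint]
    exact hRHS

/-- **Leaf bound in norm**: if `‖F(y)‖ ≤ D ‖y − y₀‖^m e^{-2λ‖y − y₀‖²}` then
`‖∫ F‖ ≤ D (√λ)⁻¹^{m+d} I_m`. [cite: Sbierski2015, §4 (proof of the theorem)] -/
theorem norm_integral_le_of_norm_le (y₀ : V) (m : ℕ) {D lam : ℝ} (hD : 0 ≤ D) (hlam : 0 < lam)
    {F : V → E} (hF : ∀ y, ‖F y‖ ≤ D * (‖y - y₀‖ ^ m * exp (-2 * lam * ‖y - y₀‖ ^ 2))) :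
    ‖∫ y, F y‖ ≤ D * ((√lam)⁻¹ ^ (m + Module.finrank ℝ V) * ∫ z : V, ‖z‖ ^ m * exp (-2 * ‖z‖ ^ 2)) :=
  (norm_integral_le_integral_norm _).trans (integral_le_of_le_norm_sub_pow_mul_exp y₀ m hD hlam hF)

/-- A weaker Gaussian dominates: `e^{-2λq} ≤ e^{-2λc r²}` when `c r² ≤ q` and `λ ≥ 0`. [folklore] -/
theorem exp_neg_mul_le_of_le {lam c r q : ℝ} (hlam : 0 ≤ lam) (h : c * r ^ 2 ≤ q) :
    exp (-2 * lam * q) ≤ exp (-2 * lam * c * r ^ 2) := by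
  apply Real.exp_le_exp.2
  nlinarith

/-! ### Uniform flat bounds from vanishing transversal jets -/

omit [FiniteDimensional ℝ V] [MeasurableSpace V] [BorelSpace V] in
/-- **Uniform flat bound** (the step `|f(x)| ≤ C |x̲|^{S+1}` of Sbierski's proof of the first lemma
of §3, along a moving centre): for `f ∈ C^∞_c(ℝ × V, E)` whose `y`-derivatives of order `≤ S`
vanish at `y = ξ(t)` for every `t` (`ξ` smooth), there is `D ≥ 0` with
`‖f(t, y)‖ ≤ D ‖y − ξ(t)‖^{S+1}` for all `t, y`. [cite: Sbierski2015, §3 (first lemma, proof)] -/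
theorem exists_norm_le_norm_sub_pow (ξ : ℝ → V) (hξ : ContDiff ℝ ∞ ξ) (f : ℝ × V → E)
    (hf : ContDiff ℝ ∞ f) (hsupp : HasCompactSupport f) (S : ℕ)
    (hvan : ∀ t : ℝ, ∀ k ≤ S, iteratedFDeriv ℝ k (fun y : V ↦ f (t, y)) (ξ t) = 0) :
    ∃ D : ℝ, 0 ≤ D ∧ ∀ t y, ‖f (t, y)‖ ≤ D * ‖y - ξ t‖ ^ (S + 1) := by
  -- the sheared function `g(t, v) = f(t, v + ξ(t))`
  set g : ℝ × V → E := fun p ↦ f (p.1, p.2 + ξ p.1) with hg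
  have hgdiff : ContDiff ℝ ∞ g :=
    hf.comp (contDiff_fst.prodMk (contDiff_snd.add (hξ.comp contDiff_fst)))
  have hξc : Continuous ξ := hξ.continuous
  let Φ : ℝ × V ≃ₜ ℝ × V :=
    { toFun := fun p ↦ (p.1, p.2 + ξ p.1)
      invFun := fun p ↦ (p.1, p.2 - ξ p.1)
      left_inv := fun p ↦ by simp
      right_inv := fun p ↦ by simp
      continuous_toFun := continuous_fst.prodMk (continuous_snd.add (hξc.comp continuous_fst))
      continuous_invFun := continuous_fst.prodMk (continuous_snd.sub (hξc.comp continuous_fst)) }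
  have hgsupp : HasCompactSupport g := hsupp.comp_homeomorph Φ
  have hgvan : ∀ t : ℝ, ∀ k ≤ S, iteratedFDeriv ℝ k (fun y : V ↦ g (t, y)) 0 = 0 := by
    intro t k hk
    have h := iteratedFDeriv_comp_add_right (𝕜 := ℝ) (f := fun z : V ↦ f (t, z)) k (ξ t) (0 : V)
    simp only [zero_add] at h
    exact h.trans (hvan t k hk)
  -- a uniform bound on the `(S+1)`-st derivative of `g`
  obtain ⟨D, hD⟩ := (hgdiff.continuous_iteratedFDeriv (m := S + 1) (by exact_mod_cast le_top)
    ).bounded_above_of_compact_support (hgsupp.iteratedFDeriv (S + 1))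
  have hD0 : 0 ≤ D := (norm_nonneg _).trans (hD 0)
  refine ⟨D / S.factorial, by positivity, fun t y ↦ ?_⟩
  have hFt : ContDiff ℝ (S + 1 : ℕ) fun z : V ↦ g (t, z) :=
    (hgdiff.of_le (by exact_mod_cast le_top)).comp (contDiff_const.prodMk contDiff_id)
  have hflat := norm_le_of_iteratedFDeriv_eq_zero hFt (hgvan t)
    (fun z ↦ (norm_iteratedFDeriv_slice_le hgdiff t (by exact_mod_cast le_top) z).trans (hD _))
    (y - ξ t)
  have hval : g (t, y - ξ t) = f (t, y) := by simp [hg]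
  rw [hval] at hflat
  calc ‖f (t, y)‖ ≤ D * ‖y - ξ t‖ ^ (S + 1) / S.factorial := hflat
    _ = D / S.factorial * ‖y - ξ t‖ ^ (S + 1) := by ring

/-- **Uniform bound** for a continuous compactly supported function of `(t, y)` (the case "`S = −1`":
no vanishing). [folklore] -/
theorem exists_norm_le_of_hasCompactSupport {W F : Type*} [TopologicalSpace W]
    [NormedAddCommGroup F] (f : ℝ × W → F) (hf : Continuous f)
    (hsupp : HasCompactSupport f) : ∃ D : ℝ, 0 ≤ D ∧ ∀ t y, ‖f (t, y)‖ ≤ D := by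
  obtain ⟨D, hD⟩ := hf.bounded_above_of_compact_support hsupp
  exact ⟨max D 0, le_max_right _ _, fun t y ↦ (hD (t, y)).trans (le_max_left _ _)⟩

end Literature.Analysis.Asymptotics.GaussianBeam
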